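import Literature.AlgebraicGeometry.Modules.RankOneModuleDivisorDictionary
import HarnessLib

/-!
# `[𝒪_Y(g^*D)] = g^*[𝒪_X(D)]` for an ARBITRARY morphism of integral schemes
# (Görtz–Wedhorn I, Prop. 11.21 with (11.16))

Layer `Literature/AlgebraicGeometry/Modules`, namespaces `Literature.AlgebraicGeometry.Modules.UnitCocycle`
and `Literature.AlgebraicGeometry.Motives.CartierDivisor`. THEOREMS ONLY (no definition, no named fact,
no instance). Sequel of `Modules/RankOneModuleDivisorDictionary` (`DivCl(X) ≅ Ȟ¹(X, 𝒪_X^×)`,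
`CartierDivisor.cechClass_eq_iff_linEquiv`), whose compatibility with pull-back
(`cechClass_pullback`, `cechClass_classPullback`) is stated there for DOMINANT morphisms only.

Here `g : Y ⟶ X` is an arbitrary morphism of integral schemes — the case of the inclusion of a
fibre `X_t ↪ X ×_K T`, which is what restriction of line bundles to fibres (the seesaw currency
`CartierDivisor.trivialLocus` of `Motives/SeesawTheorem`, the module currency
`Scheme.Modules.pullback`) needs. The divisor side is the tree's class pull-back
`CartierDivisor.classPullback D g` (`Motives/CartierDivisorClassPullback`: move `D` off `g(η_Y)`
inside its class, then pull the local equations back through `𝒪_{X, g(η_Y)} → 𝒪_{Y, η_Y} = K(Y)`,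
`RatFn.pullbackFn`); the cocycle side is `CechPic.pullback g` (`Modules/UnitCocyclePullback`,
`g^♯` on the transition functions). We prove they agree:

* `RatFn.ofSection_appLE_eq_pullbackFn` — the rational function of `g^*(s)|_V` is `pullbackFn g`
  of the rational function of `s` (Mathlib `Scheme.Hom.germ_stalkMap_apply`);
* `UnitCocycle.ratFn_pullback` — the local equations of the pulled-back cocycle are
  `pullbackFn g (f_{g y} / f_{g η_Y})`;
* `CartierDivisor.sameDivisor_toCartierDivisor_pullback_classPullback` — the divisor of the
  pulled-back cocycle of `𝒪_X(D)` IS (same divisor, Görtz–Wedhorn I Def. 11.20) the class pull-back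
  `D.classPullback g`: both are built from the chart `U_{i(g η_Y)}`;
* `CartierDivisor.pullback_cechClass_eq_cechClass_classPullback` — **`g^*[𝒪_X(D)] = [𝒪_Y(g^*D)]` in
  `Ȟ¹(Y, 𝒪_Y^×)` for every morphism `g` of integral schemes** (Görtz–Wedhorn I, (11.16) p. 392:
  `g^*𝒪_X(D) ≅ 𝒪_Y(g^*D)` whenever `g^*D` is defined, transported to classes by Prop. 11.21).

## References

* U. Görtz, T. Wedhorn, *Algebraic Geometry I: Schemes*, 2nd ed. (2020): Prop. 11.21 (p. 374),
  (11.16) Def. 11.49 – Prop. 11.50 (p. 392). [GortzWedhorn2020]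
* R. Hartshorne, *Algebraic Geometry* (1977), II.6, p. 145 (`f^*` on `CaCl`/`Pic`). [Hartshorne1977]
-/

noncomputable section

open CategoryTheory AlgebraicGeometry Opposite TopologicalSpace

universe u

namespace Literature.AlgebraicGeometry.Motives

namespace RatFn

variable {X Y : Scheme.{u}} [IsIntegral X] [IsIntegral Y] (g : Y ⟶ X)

/-- **The rational function of a pulled-back section**: for `s ∈ Γ(U, 𝒪_X)` and a non-empty open
`V ≤ g⁻¹U` of `Y`, the rational function of `g^*(s)|_V` is `pullbackFn g` of the rational function
of `s` (`g^♯` commutes with germs, Mathlib `Scheme.Hom.germ_stalkMap_apply`; Görtz–Wedhorn I,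
(11.16): `𝒪_X → g_*𝒪_Y` on the functions defined at `g(η_Y)`). [cite: GortzWedhorn2020, Def. 11.49 and Prop. 11.50 (p. 392)] -/
theorem ofSection_appLE_eq_pullbackFn {U : X.Opens} {V : Y.Opens} (hV : genericPoint Y ∈ V)
    (e : V ≤ g ⁻¹ᵁ U) (s : Γ(X, U)) :
    ofSection hV (g.appLE U V e s) = pullbackFn g (ofSection (genericPoint_mem_of_mem (e hV)) s) := by
  have hξ : g (genericPoint Y) ∈ U := e hV
  rw [Scheme.Hom.appLE, CommRingCat.comp_apply, ofSection_map,
    ofSection_eq_toFunctionField hξ s, pullbackFn_toFunctionField, Scheme.Hom.germ_stalkMap_apply]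
  exact ofSection_eq_toFunctionField (show genericPoint Y ∈ g ⁻¹ᵁ U from hξ) (g.app U s)

end RatFn

end Literature.AlgebraicGeometry.Motives

namespace Literature.AlgebraicGeometry.Modules

namespace UnitCocycle

open Literature.AlgebraicGeometry.Motives Literature.AlgebraicGeometry.Motives.RatFn

variable {X Y : Scheme.{u}} [IsIntegral X] [IsIntegral Y] (g : Y ⟶ X) (c : UnitCocycle X)

/-- **The local equations of a pulled-back cocycle**: `f^{g^*c}_y = pullbackFn g (f_{g y} / f_{g η_Y})`
(the transition function `g_{g y, g η_Y}` pulled back along `g` and read at `η_Y`).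
[cite: GortzWedhorn2020, Prop. 11.21 (p. 374) and Def. 11.49 (p. 392)] -/
theorem ratFn_pullback (y : Y) :
    (pullback g c).ratFn y = pullbackFn g (c.ratFn (g.base y) / c.ratFn (g.base (genericPoint Y))) := by
  refine (ofSection_appLE_eq_pullbackFn g ((pullback g c).genericPoint_mem_genOpen y)
    (le_preimage_inf g inf_le_left inf_le_right) (c.gInf (g.base y) (g.base (genericPoint Y)))).trans
    ?_
  rw [c.ratFn_div_ratFn]

end UnitCocycle

end Literature.AlgebraicGeometry.Modules

namespace Literature.AlgebraicGeometry.Motives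

namespace CartierDivisor

open RatFn Literature.AlgebraicGeometry.Modules

variable {X Y : Scheme.{u}} [IsIntegral X] [IsIntegral Y] (D : CartierDivisor X) (g : Y ⟶ X)

/-- The image of the generic point of `Y` lies in the chart of `D` chosen at `g y`, for every `y`
(it specialises to `g y` and charts are open). [folklore] -/
private theorem apply_genericPoint_mem_U_chartIdx (y : Y) :
    g.base (genericPoint Y) ∈ D.U (D.chartIdx (g.base y)) :=
  (g.base.hom.map_specializes ((genericPoint_spec Y).specializes (Set.mem_univ y))).mem_open
    (D.U _).2 (D.mem_U_chartIdx (g.base y))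

/-- **The divisor of the pulled-back cocycle of `𝒪_X(D)` is the class pull-back `g^*D`** — the SAME
Cartier divisor (Görtz–Wedhorn I, Def. 11.20): both are presented through the chart `U_{i₀}`,
`i₀ = i(g η_Y)`, with local equations `pullbackFn g (f_{i(g y)} / f_{i₀})` resp.
`pullbackFn g (f_p f_{i₀}⁻¹)`, whose ratio `pullbackFn g (f_{i(g y)} / f_p)` is a unit.
[cite: GortzWedhorn2020, Def. 11.20 (p. 373) and Def. 11.49 (p. 392)] -/
theorem sameDivisor_toCartierDivisor_pullback_classPullback :
    (UnitCocycle.pullback g D.toUnitCocycle).toCartierDivisor.SameDivisor (D.classPullback g) := by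
  intro y p z hzy hzp
  -- notation
  have hξ0 : g.base (genericPoint Y) ∈ D.U (D.chartIdx (g.base (genericPoint Y))) :=
    D.mem_U_chartIdx _
  have hξy : g.base (genericPoint Y) ∈ D.U (D.chartIdx (g.base y)) :=
    D.apply_genericPoint_mem_U_chartIdx g y
  -- the local equation of the pulled-back cocycle at `y`
  have hF : (UnitCocycle.pullback g D.toUnitCocycle).toCartierDivisor.f y =
      pullbackFn g (D.f (D.chartIdx (g.base y)) / D.f (D.chartIdx (g.base (genericPoint Y)))) := by
    change (UnitCocycle.pullback g D.toUnitCocycle).ratFn y = _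
    rw [UnitCocycle.ratFn_pullback, ratFn_toUnitCocycle, ratFn_toUnitCocycle,
      div_div_div_cancel_right₀ (D.f_ne_zero _)]
  -- the local equation of the class pull-back at `p`
  have hG : (D.classPullback g).f p =
      pullbackFn g (D.f p.1.1 * (D.f (D.chartIdx (g.base (genericPoint Y))))⁻¹) := rfl
  have hreg₁ : IsRegularAt (g.base (genericPoint Y))
      (D.f (D.chartIdx (g.base y)) / D.f (D.chartIdx (g.base (genericPoint Y)))) :=
    (D.isUnitAt_div _ _ _ hξy hξ0).isRegularAt
  have hreg₂ : IsUnitAt (g.base (genericPoint Y))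
      (D.f p.1.1 * (D.f (D.chartIdx (g.base (genericPoint Y))))⁻¹) := by
    rw [← div_eq_mul_inv]
    exact D.isUnitAt_div _ _ _ p.2.1 hξ0
  rw [hF, hG, ← pullbackFn_div g hreg₁ hreg₂]
  have e : D.f (D.chartIdx (g.base y)) / D.f (D.chartIdx (g.base (genericPoint Y))) /
      (D.f p.1.1 * (D.f (D.chartIdx (g.base (genericPoint Y))))⁻¹) =
      D.f (D.chartIdx (g.base y)) / D.f p.1.1 := by
    have h1 := D.f_ne_zero (D.chartIdx (g.base (genericPoint Y)))
    have h2 := D.f_ne_zero p.1.1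
    field_simp
  rw [e]
  exact (D.isUnitAt_div _ _ (g.base z) hzy hzp.1).pullbackFn

/-- **`[𝒪_Y(g^*D)] = g^*[𝒪_X(D)]` in `Ȟ¹(Y, 𝒪_Y^×)` for an ARBITRARY morphism `g : Y → X` of
integral schemes** (Görtz–Wedhorn I, (11.16), p. 392: `g^*𝒪_X(D) ≅ 𝒪_Y(g^*D)`, with `g^*D` the
class pull-back; the dominant case is `cechClass_classPullback` of
`Modules/RankOneModuleDivisorDictionary`). [cite: GortzWedhorn2020, Prop. 11.21 (p. 374) and Def. 11.49 (p. 392)]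
[cite: Hartshorne1977, II.6 (p. 145)] -/
theorem pullback_cechClass_eq_cechClass_classPullback :
    CechPic.pullback g D.cechClass = (D.classPullback g).cechClass := by
  rw [cechClass_eq_mk, cechClass_eq_mk, CechPic.pullback_mk]
  refine CechPic.sound ((UnitCocycle.equiv_iff_toCartierDivisor_linEquiv _ _).2 ?_)
  exact (D.sameDivisor_toCartierDivisor_pullback_classPullback g).linEquiv.trans
    (D.classPullback g).toCartierDivisor_toUnitCocycle_linEquiv.symm

variable {D} in
/-- Class pull-back along an arbitrary morphism respects the classes: `D ∼ E ⟹ [g^*D] = [g^*E]`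
(immediate from `pullback_cechClass_eq_cechClass_classPullback`; also ★ `LinEquiv.classPullback`).
[cite: GortzWedhorn2020, Prop. 11.21 (p. 374) and Def. 11.49 (p. 392)] -/
theorem LinEquiv.cechClass_classPullback_eq {E : CartierDivisor X} (h : D.LinEquiv E) :
    (D.classPullback g).cechClass = (E.classPullback g).cechClass := by
  rw [← pullback_cechClass_eq_cechClass_classPullback, ← pullback_cechClass_eq_cechClass_classPullback,
    h.cechClass_eq]

end CartierDivisor

end Literature.AlgebraicGeometry.Motives

end
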